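import Literature.MathematicalPhysics.QuantumFieldTheory.Balaban1983to89.B9CubeLettersInvReadings
import Literature.MathematicalPhysics.QuantumFieldTheory.Balaban1983to89.Node00.OpsYRead342

/-!
# `Balaban1983to89.B9CubeLettersInvReadDict` — T. Bałaban, *Propagators for lattice gauge theories in a background field*, Commun. Math. Phys.
# **99** (1985) 389–434 [Balaban1985BackgroundPropagators], (3.42) p. 397 READ over the gauge-invariant test class: the (3.42) block of
# `kernelFamilySInv` made POINTWISE for every test function, its real-coordinate block majorants ([4] (2.51)), and the dictionary to def-Y's
# product-class reading (same constants)

statement-level skeleton of published theorems with citation tags; proofs where landed; nothing here is a claim about the Yang–Mills mass gap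

PDF held: `paper:balaban1985-cmp99-background-propagators` (journal page = PDF page + 388); p. 397 read from the held text layer; [4] =
[Balaban1984PropagatorsII] (2.51) p. 232 («|(Tλ)(x)| ≦ K(y,y′)|λ|»).

THE PRINT.  p. 397, Theorem 3.1 (3.42): *«|(G′(U)λ)(x)|, |(∇_U G′(U)λ)(x)|, |(G′(U)∇*_U λ)(x)|, |(Δ_U G′(U)λ)(x)| ≦ B₀[(Lʲη)², Lʲη, Lʲη, 1]e^{−δ₀d(y,y′)}|λ|
for x ∈ Δ(y), y ∈ Λ_j, supp λ ⊂ Δ(y′)»*, with (3.39) *«|λ| = sup_x |λ(x)|»* over all 𝔤- (M_N-) valued `λ`.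

WHY THIS FILE (cell context: G-B9-LETTERS, the dictionary of module M5.2; consumers M5.4-est (p38, the (3.89) commutator bound reads G′_□ through its
(3.42)₁,₂ lines), M5.5 (the Theorem 3.7 summation `B9Thm37Sum.thm37_entry1`, whose inputs `hT`∕`h342_*` are block majorants of real-coordinate letters),
M5.1b (which must WRITE the block)).  The cube letters' (3.42) block at a configuration is `B9FromB6.EBlock (kernelFamilySInv i B cfg O par) B₀ δ U₁`
(`B9CubeLettersInvReadings.kernelFamilySInv`: the outer sup over `Λ ∈ TestY 𝔸 f`).  An upper bound on a real `⨆` is informative only once the family is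
bounded above; §1 supplies that device for the invariant class — every `Λ ∈ TestY 𝔸 f` decomposes as `Σ_z Σ_j repr_j(Λ(z))·(δ_z ⊗ b_j)` over a real basis
`b` of `𝔸` with coordinate constant `M₂`, so an ℝ-linear image is bounded UNIFORMLY in `Λ` (`norm_apply_le_of_testY`).  Hence (§2) the four entries of the
Inv family dominate def-Y's product entries (`kernelFamilyS_e_le`) and ★ `eBlock_kernelFamilyS_of_eBlockInv` (SAME constants); (§3) ★★ the block READ
POINTWISE for every test function of the class (`sq_eta_mul_norm_le_of_eBlockInv`, `eta_mul_norm_cdS_le_of_eBlockInv`, `eta_mul_norm_cdsS_le_of_eBlockInv`,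
`norm_lapS_le_of_eBlockInv`); (§4) ★★ the four [4]-(2.51) block majorants of the conj-`b` letters `η²O(V)`, `(η⁻¹∇_μ)·(η²O)`, `(η²O)·(−η⁻¹∇*_μ)`, `(η⁻²Δ)·(η²O)`
with constant `M₂(Σ_j‖b_j‖)B₀` and the SAME rate — def-Y's `Node00.OpsYRead342` §4 theorems through §2 (`hasMajorant_conj_G_of_eBlockInv`, …).  Nothing of
def-Y's dictionary is restated: its bookkeeping (`norm_le_supBlkS`, `gradF_mul_apply`, `hasMajorant_conj_of_ball_bound`, the four READ majorants) is used by
name; corner-free members only (a section `ιB` of `β`, exactly as there).  The WRITE half for the Inv family is the sibling `B9CubeLettersInvWriteDict`.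

WHAT IS PROVED (all `theorem`s, no `sorry`).  §1 `le_iSup_testY`, `iSup_testY_le`, `eq_sum_deltaY`, `deltaY_eq_sum_repr`, ★ `norm_apply_le_of_testY`;
§2 `eLatS_le_unif` (n = 0,1,2,3), `kernelFamilyS_e_le`, ★ `eBlock_kernelFamilyS_of_eBlockInv`; §3 the four pointwise READ theorems; §4 the four majorants.
-/

noncomputable section

namespace Literature.MathematicalPhysics.QuantumFieldTheory.Balaban1983to89.B9CubeLettersInvReadDict

open Node00 B9CubeLettersInvReadings
open Node00.OpsYRead342 (norm_le_supBlkS norm_le_supBlkS' hasMajorant_conj_G_of_eBlock hasMajorant_gradF_mul_G_of_eBlock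
  hasMajorant_G_mul_gradB_of_eBlock hasMajorant_lap_mul_G_of_eBlock)
open B6Geom246MultiLevelBox (blkOf)
open B6Ineq2142KLevelV1 (β)
open B6KLevelCensusIndexV1 (KIdx)
open B6Prop22KLevelCensusEta (epow)
open B6RandomWalk (HasMajorant)
open B9Thm34Ext (toB6)
open B9FromB6 (EBlock)
open B9GeoNormsKLevelV1 (geo9K geo9K_supNorm_nonneg)
open B9Eq352DivFormLetters (conj)
open B9Eq352GradLetters (diffLetter)
open B9Ineq347AllEntries (pref4_nonneg)
open B9Ineq349SiteComposite (cdSL cdsSL supBlkS_le supBlkS'_le etaS_pos)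
open B9CoReadingCoordsS (lapSₗ lapSₗ_apply)
open scoped Matrix

variable {d ℓ : ℕ} {hd : 1 ≤ d + 1} {hL : Odd (ℓ + 1) ∧ 1 < ℓ + 1} {b₀ b₁ : ℝ}
variable {𝔸 : Type} [NormedRing 𝔸] [NormedAlgebra ℂ 𝔸] [CompleteSpace 𝔸]
variable {ι : Type} [Fintype ι]
variable (i : KIdx d ℓ hd hL b₀ b₁) (b : Module.Basis ι ℝ 𝔸)

/-! ## §1 The boundedness device of the invariant class: `Λ = Σ_z Σ_j repr_j(Λ(z))·(δ_z ⊗ b_j)` -/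

section Device

variable {X : Type}

omit [NormedAlgebra ℂ 𝔸] [CompleteSpace 𝔸] [Fintype ι] in
/-- the sup over the class dominates each member, once a uniform bound is known. [cite: Balaban1985BackgroundPropagators, (3.39) p.397 (sup over λ), bookkeeping] -/
theorem le_iSup_testY {f : X → ℝ} {F : TestY 𝔸 f → ℝ} {C : ℝ} (hC : ∀ Λ, F Λ ≤ C) (Λ : TestY 𝔸 f) : F Λ ≤ ⨆ Λ', F Λ' :=
  le_ciSup ⟨C, by rintro _ ⟨Λ', rfl⟩; exact hC Λ'⟩ Λ

omit [NormedAlgebra ℂ 𝔸] [CompleteSpace 𝔸] [Fintype ι] in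
/-- a bound on every member bounds the sup over the class (no boundedness needed). [cite: Balaban1985BackgroundPropagators, (3.39) p.397, bookkeeping] -/
theorem iSup_testY_le {f : X → ℝ} {F : TestY 𝔸 f → ℝ} {a : ℝ} (h : ∀ Λ, F Λ ≤ a) (ha : 0 ≤ a) : (⨆ Λ, F Λ) ≤ a := Real.iSup_le h ha

omit [NormedAlgebra ℂ 𝔸] [CompleteSpace 𝔸] [Fintype ι] in
/-- every lattice function is the sum of its one-site pieces: `Λ = Σ_z δ_z ⊗ Λ(z)`. [cite: Balaban1985BackgroundPropagators, (3.48) p.398 (kernels), bookkeeping] -/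
theorem eq_sum_deltaY [Fintype X] (Λ : X → 𝔸) : Λ = ∑ z, deltaY z (Λ z) := by
  funext w
  rw [Finset.sum_apply, Finset.sum_eq_single w]
  · unfold deltaY
    rw [if_pos rfl]
  · intro z _ hz
    unfold deltaY
    rw [if_neg (Ne.symm hz)]
  · intro h
    exact absurd (Finset.mem_univ w) h

omit [CompleteSpace 𝔸] [Fintype ι] in
/-- the basis decomposition of a one-site piece: `δ_z ⊗ E = Σ_j repr_j(E)·(δ_z ⊗ b_j)`. [cite: Balaban1985BackgroundPropagators, (3.39) p.397, bookkeeping] -/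
theorem deltaY_eq_sum_repr [Fintype ι] (z : X) (E : 𝔸) : deltaY (X := X) z E = ∑ j, (b.repr E j) • deltaY z (b j) := by
  funext w
  rw [Finset.sum_apply]
  by_cases hw : w = z
  · have h1 : ∀ F : 𝔸, deltaY (X := X) z F w = F := fun F => if_pos hw
    simp only [Pi.smul_apply, h1]
    exact (b.sum_repr E).symm
  · have h0 : ∀ F : 𝔸, deltaY (X := X) z F w = 0 := fun F => if_neg hw
    simp only [Pi.smul_apply, h0, smul_zero, Finset.sum_const_zero]

omit [CompleteSpace 𝔸] in
/-- ★ **THE UNIFORM BOUND OVER THE INVARIANT CLASS**: for an ℝ-linear `T` on `𝔸`-valued lattice functions and a real basis `b` of `𝔸` with coordinate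
bound `|repr_j v| ≤ M₂‖v‖`, every `Λ` with `‖Λ(z)‖ ≤ |f(z)|` has `‖(TΛ)(w)‖ ≤ M₂·Σ_z |f(z)|·Σ_j Σ_{w′} ‖(T(δ_z ⊗ b_j))(w′)‖` — uniformly in `Λ` (and `w`).
[cite: Balaban1985BackgroundPropagators, (3.39) + (3.42) p.397 (the sup over all λ is attained on a bounded family), bookkeeping] -/
theorem norm_apply_le_of_testY [Fintype X] (T : Module.End ℝ (X → 𝔸)) {M₂ : ℝ} (hM₂ : 0 ≤ M₂)
    (hrepr : ∀ (v : 𝔸) (j : ι), |b.repr v j| ≤ M₂ * ‖v‖) (f : X → ℝ) (Λ : TestY 𝔸 f) (w : X) :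
    ‖T Λ.1 w‖ ≤ M₂ * ∑ z, |f z| * ∑ j, ∑ w', ‖T (deltaY z (b j)) w'‖ := by
  have hΛ : Λ.1 = ∑ z, ∑ j, (b.repr (Λ.1 z) j) • deltaY z (b j) := by
    conv_lhs => rw [eq_sum_deltaY Λ.1]
    exact Finset.sum_congr rfl fun z _ => deltaY_eq_sum_repr b z (Λ.1 z)
  rw [hΛ, map_sum, Finset.sum_apply, Finset.mul_sum]
  refine (norm_sum_le _ _).trans (Finset.sum_le_sum fun z _ => ?_)
  rw [map_sum, Finset.sum_apply]
  calc ‖∑ j, T ((b.repr (Λ.1 z) j) • deltaY z (b j)) w‖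
      ≤ ∑ j, ‖T ((b.repr (Λ.1 z) j) • deltaY z (b j)) w‖ := norm_sum_le _ _
    _ ≤ ∑ j, M₂ * |f z| * ∑ w', ‖T (deltaY z (b j)) w'‖ := Finset.sum_le_sum fun j _ => by
        rw [map_smul, Pi.smul_apply, norm_smul, Real.norm_eq_abs]
        refine mul_le_mul ((hrepr _ j).trans (mul_le_mul_of_nonneg_left (Λ.2 z) hM₂)) ?_ (norm_nonneg _) (mul_nonneg hM₂ (abs_nonneg _))
        exact Finset.single_le_sum (f := fun w' => ‖T (deltaY z (b j)) w'‖) (fun _ _ => norm_nonneg _) (Finset.mem_univ w)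
    _ = M₂ * (|f z| * ∑ j, ∑ w', ‖T (deltaY z (b j)) w'‖) := by
        rw [Finset.mul_sum, Finset.mul_sum]
        exact Finset.sum_congr rfl fun j _ => by ring

end Device

/-! ## §2 The four (3.42) entries over the class are bounded above; they dominate def-Y's product entries; the block dictionary -/

section Dominate

variable {M₂ : ℝ} (hM₂ : 0 ≤ M₂) (hrepr : ∀ (v : 𝔸) (j : ι), |b.repr v j| ≤ M₂ * ‖v‖) (O : SiteOpY 𝔸 i) (V : CfgY 𝔸 i)
include hM₂ hrepr

omit [CompleteSpace 𝔸] in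
omit hrepr in
/-- the uniform bound of §1 is non-negative. [cite: Balaban1985BackgroundPropagators, (3.42) p.397, bookkeeping] -/
private theorem sum3_nonneg (T : Module.End ℝ (SiteY i → 𝔸)) (f : SiteY i → ℝ) :
    0 ≤ M₂ * ∑ z, |f z| * ∑ j, ∑ w', ‖T (deltaY z (b j)) w'‖ :=
  mul_nonneg hM₂ (Finset.sum_nonneg fun _ _ => mul_nonneg (abs_nonneg _)
    (Finset.sum_nonneg fun _ _ => Finset.sum_nonneg fun _ _ => norm_nonneg _))

/-- entry 0 over the class is uniformly bounded. [cite: Balaban1985BackgroundPropagators, (3.42) p.397 (first member), bookkeeping] -/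
theorem eLatS_zero_le_unif (f : SiteY i → ℝ) (Λ : TestY 𝔸 f) (s : BlkY i) :
    eLatS i O V Λ.1 s 0 ≤ M₂ * ∑ z, |f z| * ∑ j, ∑ w', ‖((O V).restrictScalars ℝ) (deltaY z (b j)) w'‖ :=
  supBlkS_le i _ _ (sum3_nonneg i b hM₂ _ f) fun w _ => norm_apply_le_of_testY b ((O V).restrictScalars ℝ) hM₂ hrepr f Λ w

/-- entry 1 over the class is uniformly bounded. [cite: Balaban1985BackgroundPropagators, (3.42) p.397 (second member), bookkeeping] -/
theorem eLatS_one_le_unif (f : SiteY i → ℝ) (Λ : TestY 𝔸 f) (s : BlkY i) :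
    eLatS i O V Λ.1 s 1 ≤ ∑ ν : Fin (d + 1), M₂ * ∑ z, |f z| * ∑ j, ∑ w',
      ‖((cdSL i V ν).restrictScalars ℝ ∘ₗ (O V).restrictScalars ℝ) (deltaY z (b j)) w'‖ :=
  supBlkS'_le i _ _ (Finset.sum_nonneg fun _ _ => sum3_nonneg i b hM₂ _ f) fun w ν _ =>
    (norm_apply_le_of_testY b ((cdSL i V ν).restrictScalars ℝ ∘ₗ (O V).restrictScalars ℝ) hM₂ hrepr f Λ w).trans
      (Finset.single_le_sum (f := fun ν : Fin (d + 1) => M₂ * ∑ z, |f z| * ∑ j, ∑ w',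
        ‖((cdSL i V ν).restrictScalars ℝ ∘ₗ (O V).restrictScalars ℝ) (deltaY z (b j)) w'‖)
        (fun _ _ => sum3_nonneg i b hM₂ _ f) (Finset.mem_univ ν))

/-- entry 2 over the class is uniformly bounded. [cite: Balaban1985BackgroundPropagators, (3.42) p.397 (third member), bookkeeping] -/
theorem eLatS_two_le_unif (f : SiteY i → ℝ) (Λ : TestY 𝔸 f) (s : BlkY i) :
    eLatS i O V Λ.1 s 2 ≤ ∑ ν : Fin (d + 1), M₂ * ∑ z, |f z| * ∑ j, ∑ w',
      ‖((O V).restrictScalars ℝ ∘ₗ (cdsSL i V ν).restrictScalars ℝ) (deltaY z (b j)) w'‖ :=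
  supBlkS'_le i _ _ (Finset.sum_nonneg fun _ _ => sum3_nonneg i b hM₂ _ f) fun w ν _ =>
    (norm_apply_le_of_testY b ((O V).restrictScalars ℝ ∘ₗ (cdsSL i V ν).restrictScalars ℝ) hM₂ hrepr f Λ w).trans
      (Finset.single_le_sum (f := fun ν : Fin (d + 1) => M₂ * ∑ z, |f z| * ∑ j, ∑ w',
        ‖((O V).restrictScalars ℝ ∘ₗ (cdsSL i V ν).restrictScalars ℝ) (deltaY z (b j)) w'‖)
        (fun _ _ => sum3_nonneg i b hM₂ _ f) (Finset.mem_univ ν))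

/-- entry 3 over the class is uniformly bounded. [cite: Balaban1985BackgroundPropagators, (3.42) p.397 (fourth member), bookkeeping] -/
theorem eLatS_three_le_unif (f : SiteY i → ℝ) (Λ : TestY 𝔸 f) (s : BlkY i) :
    eLatS i O V Λ.1 s 3 ≤ M₂ * ∑ z, |f z| * ∑ j, ∑ w', ‖(lapSₗ i V ∘ₗ (O V).restrictScalars ℝ) (deltaY z (b j)) w'‖ :=
  supBlkS_le i _ _ (sum3_nonneg i b hM₂ _ f) fun w _ => by
    have h := norm_apply_le_of_testY b (lapSₗ i V ∘ₗ (O V).restrictScalars ℝ) hM₂ hrepr f Λ w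
    rw [LinearMap.comp_apply, lapSₗ_apply] at h
    exact h

omit [Fintype ι] in
omit hM₂ hrepr in
/-- the four (3.42) entries are non-negative. [cite: Balaban1985BackgroundPropagators, (3.42) p.397, bookkeeping] -/
theorem eLatS_nonneg (Λ : SiteY i → 𝔸) (s : BlkY i) (n : Fin 4) : 0 ≤ eLatS i O V Λ s n := by
  fin_cases n
  · show 0 ≤ supBlkS i s (O V Λ)
    exact B9Ineq349SiteReading.supBlkS_nonneg i s (O V Λ)
  · show 0 ≤ supBlkS' i s (fun μ => cdS i V μ (O V Λ))
    exact B9Ineq349SiteReading.supBlkS'_nonneg i s _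
  · show 0 ≤ supBlkS' i s (fun μ => O V (cdsS i V μ Λ))
    exact B9Ineq349SiteReading.supBlkS'_nonneg i s _
  · show 0 ≤ supBlkS i s (lapS i V (O V Λ))
    exact B9Ineq349SiteReading.supBlkS_nonneg i s _

variable {B : B9.Backgrounds} (cfg : B.Cfg → CfgY 𝔸 i) (par : SiteParY 𝔸 i)

/-- ★ **def-Y's PRODUCT ENTRIES ARE DOMINATED BY THE ENTRIES OVER THE CLASS** (`f ⊗ E ∈ TestY 𝔸 f` for `‖E‖ ≤ 1`; the class sup is bounded above by §1):
`(kernelFamilyS …).e n U λ y ≤ (kernelFamilySInv …).e n U λ y`. [cite: Balaban1985BackgroundPropagators, (3.39) + (3.42) p.397] -/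
theorem kernelFamilyS_e_le (n : Fin 4) (U : B.Cfg) (lam : (geo9K i).Loc) (y : (geo9K i).Site) :
    (kernelFamilyS i B cfg O par).e n U lam y ≤ (kernelFamilySInv i B cfg O par).e n U lam y := by
  cases lam with
  | inr J => exact le_rfl
  | inl f =>
    show etaS i ^ (epow n) * (⨆ E : BallY 𝔸, eLatS i O (cfg U) (liftY f (E : 𝔸)) (β i.hN i.D i.hk y) n) ≤
      etaS i ^ (epow n) * ⨆ Λ : TestY 𝔸 f, eLatS i O (cfg U) Λ.1 (β i.hN i.D i.hk y) n
    refine mul_le_mul_of_nonneg_left ?_ (pow_nonneg (etaS_pos i).le _)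
    have hInv0 : 0 ≤ ⨆ Λ : TestY 𝔸 f, eLatS i O (cfg U) Λ.1 (β i.hN i.D i.hk y) n :=
      Real.iSup_nonneg fun Λ => eLatS_nonneg i O (cfg U) Λ.1 _ n
    refine iSup_ball_le (fun E => ?_) hInv0
    show eLatS i O (cfg U) (testYOfBall f E).1 (β i.hN i.D i.hk y) n ≤ _
    fin_cases n
    · exact le_iSup_testY (fun Λ => eLatS_zero_le_unif i b hM₂ hrepr O (cfg U) f Λ _) (testYOfBall f E)
    · exact le_iSup_testY (fun Λ => eLatS_one_le_unif i b hM₂ hrepr O (cfg U) f Λ _) (testYOfBall f E)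
    · exact le_iSup_testY (fun Λ => eLatS_two_le_unif i b hM₂ hrepr O (cfg U) f Λ _) (testYOfBall f E)
    · exact le_iSup_testY (fun Λ => eLatS_three_le_unif i b hM₂ hrepr O (cfg U) f Λ _) (testYOfBall f E)

/-- ★ **THE BLOCK DICTIONARY, SAME CONSTANTS**: the (3.42) block of the readings over the class gives the (3.42) block of def-Y's product readings.
[cite: Balaban1985BackgroundPropagators, (3.42) p.397] -/
theorem eBlock_kernelFamilyS_of_eBlockInv {B₀ δ : ℝ} {U₁ : B.Cfg} (hE : EBlock (kernelFamilySInv i B cfg O par) B₀ δ U₁) :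
    EBlock (kernelFamilyS i B cfg O par) B₀ δ U₁ :=
  fun n lam y y' hs => (kernelFamilyS_e_le i b hM₂ hrepr O cfg par n U₁ lam y).trans (hE n lam y y' hs)

end Dominate

/-! ## §3 READ pointwise: the (3.42) block over the class bounds every test function of the class -/

section Read

variable {B : B9.Backgrounds} (cfg : B.Cfg → CfgY 𝔸 i) (O : SiteOpY 𝔸 i) (par : SiteParY 𝔸 i) {B₀ δ : ℝ} {U₁ : B.Cfg}

/-- ★★ entry 0 READ pointwise over the class: `η²‖(O(V)Λ)(z)‖ ≤ B₀ℓ(y)²e^{−δd(y,y′)}|f|` for every `Λ ∈ TestY 𝔸 f`, `supp f ⊂ Δ(βy′)`, `z ∈ Δ(βy)`.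
[cite: Balaban1985BackgroundPropagators, (3.42) p.397 (first member)] -/
theorem sq_eta_mul_norm_le_of_eBlockInv (hE : EBlock (kernelFamilySInv i B cfg O par) B₀ δ U₁)
    {M₂ : ℝ} (hM₂ : 0 ≤ M₂) (hrepr : ∀ (v : 𝔸) (j : ι), |b.repr v j| ≤ M₂ * ‖v‖)
    (f : SiteY i → ℝ) (y y' : IBondY i) (hs : (geo9K i).suppIn (Sum.inl f) y') (Λ : TestY 𝔸 f)
    {z : SiteY i} (hz : blkOf i.D.toDomains z = β i.hN i.D i.hk y) :
    etaS i ^ 2 * ‖O (cfg U₁) Λ.1 z‖ ≤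
      B₀ * (geo9K i).len y ^ 2 * Real.exp (-(δ * (geo9K i).dist y y')) * (geo9K i).supNorm (Sum.inl f) := by
  have h := hE 0 (Sum.inl f) y y' hs
  have hK : (kernelFamilySInv i B cfg O par).e 0 U₁ (Sum.inl f) y =
      etaS i ^ (epow 0) * ⨆ Λ' : TestY 𝔸 f, eLatS i O (cfg U₁) Λ'.1 (β i.hN i.D i.hk y) 0 := rfl
  have h0 : epow 0 = 2 := rfl
  have hp : B9.pref4 ((geo9K i).len y) 0 = (geo9K i).len y ^ 2 := rfl
  rw [hK, h0, hp] at h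
  refine le_trans (mul_le_mul_of_nonneg_left ?_ (sq_nonneg _)) h
  have h1 := le_iSup_testY (fun Λ' => eLatS_zero_le_unif i b hM₂ hrepr O (cfg U₁) f Λ' (β i.hN i.D i.hk y)) Λ
  exact (norm_le_supBlkS i _ (O (cfg U₁) Λ.1) hz).trans h1

/-- ★★ entry 1 READ pointwise over the class: `η‖(∇_{V,μ}O(V)Λ)(z)‖ ≤ B₀ℓ(y)e^{−δd(y,y′)}|f|`. [cite: Balaban1985BackgroundPropagators, (3.42) p.397 (second member)] -/
theorem eta_mul_norm_cdS_le_of_eBlockInv (hE : EBlock (kernelFamilySInv i B cfg O par) B₀ δ U₁)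
    {M₂ : ℝ} (hM₂ : 0 ≤ M₂) (hrepr : ∀ (v : 𝔸) (j : ι), |b.repr v j| ≤ M₂ * ‖v‖)
    (f : SiteY i → ℝ) (y y' : IBondY i) (hs : (geo9K i).suppIn (Sum.inl f) y') (Λ : TestY 𝔸 f)
    {z : SiteY i} (μ : Fin (d + 1)) (hz : blkOf i.D.toDomains z = β i.hN i.D i.hk y) :
    etaS i * ‖cdS i (cfg U₁) μ (O (cfg U₁) Λ.1) z‖ ≤
      B₀ * (geo9K i).len y * Real.exp (-(δ * (geo9K i).dist y y')) * (geo9K i).supNorm (Sum.inl f) := by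
  have h := hE 1 (Sum.inl f) y y' hs
  have hK : (kernelFamilySInv i B cfg O par).e 1 U₁ (Sum.inl f) y =
      etaS i ^ (epow 1) * ⨆ Λ' : TestY 𝔸 f, eLatS i O (cfg U₁) Λ'.1 (β i.hN i.D i.hk y) 1 := rfl
  have h0 : epow 1 = 1 := rfl
  have hp : B9.pref4 ((geo9K i).len y) 1 = (geo9K i).len y := rfl
  rw [hK, h0, hp, pow_one] at h
  refine le_trans (mul_le_mul_of_nonneg_left ?_ (etaS_pos i).le) h
  have h1 := le_iSup_testY (fun Λ' => eLatS_one_le_unif i b hM₂ hrepr O (cfg U₁) f Λ' (β i.hN i.D i.hk y)) Λ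
  exact (norm_le_supBlkS' i _ (fun ν => cdS i (cfg U₁) ν (O (cfg U₁) Λ.1)) μ hz).trans h1

/-- ★★ entry 2 READ pointwise over the class: `η‖(O(V)∇*_{V,μ}Λ)(z)‖ ≤ B₀ℓ(y)e^{−δd(y,y′)}|f|`. [cite: Balaban1985BackgroundPropagators, (3.42) p.397 (third member)] -/
theorem eta_mul_norm_cdsS_le_of_eBlockInv (hE : EBlock (kernelFamilySInv i B cfg O par) B₀ δ U₁)
    {M₂ : ℝ} (hM₂ : 0 ≤ M₂) (hrepr : ∀ (v : 𝔸) (j : ι), |b.repr v j| ≤ M₂ * ‖v‖)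
    (f : SiteY i → ℝ) (y y' : IBondY i) (hs : (geo9K i).suppIn (Sum.inl f) y') (Λ : TestY 𝔸 f)
    {z : SiteY i} (μ : Fin (d + 1)) (hz : blkOf i.D.toDomains z = β i.hN i.D i.hk y) :
    etaS i * ‖O (cfg U₁) (cdsS i (cfg U₁) μ Λ.1) z‖ ≤
      B₀ * (geo9K i).len y * Real.exp (-(δ * (geo9K i).dist y y')) * (geo9K i).supNorm (Sum.inl f) := by
  have h := hE 2 (Sum.inl f) y y' hs
  have hK : (kernelFamilySInv i B cfg O par).e 2 U₁ (Sum.inl f) y =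
      etaS i ^ (epow 2) * ⨆ Λ' : TestY 𝔸 f, eLatS i O (cfg U₁) Λ'.1 (β i.hN i.D i.hk y) 2 := rfl
  have h0 : epow 2 = 1 := rfl
  have hp : B9.pref4 ((geo9K i).len y) 2 = (geo9K i).len y := rfl
  rw [hK, h0, hp, pow_one] at h
  refine le_trans (mul_le_mul_of_nonneg_left ?_ (etaS_pos i).le) h
  have h1 := le_iSup_testY (fun Λ' => eLatS_two_le_unif i b hM₂ hrepr O (cfg U₁) f Λ' (β i.hN i.D i.hk y)) Λ
  exact (norm_le_supBlkS' i _ (fun ν => O (cfg U₁) (cdsS i (cfg U₁) ν Λ.1)) μ hz).trans h1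

/-- ★★ entry 3 READ pointwise over the class: `‖(Δ_V O(V)Λ)(z)‖ ≤ B₀e^{−δd(y,y′)}|f|`. [cite: Balaban1985BackgroundPropagators, (3.42) p.397 (fourth member)] -/
theorem norm_lapS_le_of_eBlockInv (hE : EBlock (kernelFamilySInv i B cfg O par) B₀ δ U₁)
    {M₂ : ℝ} (hM₂ : 0 ≤ M₂) (hrepr : ∀ (v : 𝔸) (j : ι), |b.repr v j| ≤ M₂ * ‖v‖)
    (f : SiteY i → ℝ) (y y' : IBondY i) (hs : (geo9K i).suppIn (Sum.inl f) y') (Λ : TestY 𝔸 f)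
    {z : SiteY i} (hz : blkOf i.D.toDomains z = β i.hN i.D i.hk y) :
    ‖lapS i (cfg U₁) (O (cfg U₁) Λ.1) z‖ ≤
      B₀ * 1 * Real.exp (-(δ * (geo9K i).dist y y')) * (geo9K i).supNorm (Sum.inl f) := by
  have h := hE 3 (Sum.inl f) y y' hs
  have hK : (kernelFamilySInv i B cfg O par).e 3 U₁ (Sum.inl f) y =
      etaS i ^ (epow 3) * ⨆ Λ' : TestY 𝔸 f, eLatS i O (cfg U₁) Λ'.1 (β i.hN i.D i.hk y) 3 := rfl
  have h0 : epow 3 = 0 := rfl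
  have hp : B9.pref4 ((geo9K i).len y) 3 = 1 := rfl
  rw [hK, h0, hp, pow_zero, one_mul] at h
  refine le_trans ?_ h
  have h1 := le_iSup_testY (fun Λ' => eLatS_three_le_unif i b hM₂ hrepr O (cfg U₁) f Λ' (β i.hN i.D i.hk y)) Λ
  exact (norm_le_supBlkS i _ (lapS i (cfg U₁) (O (cfg U₁) Λ.1)) hz).trans h1

/-! ## §4 READ ⇒ the four [4]-(2.51) block majorants of the conj-`b` letters (def-Y's `OpsYRead342` §4 through the dictionary of §2) -/

variable [Fintype (geo9K i).Site] {Rr : ℝ} {Hp : Prop}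

/-- ★★ **entry 0 ⇒ the majorant of `conj b (η²O(V))`**, constant `M₂(Σ‖b_j‖)B₀`, profile `ℓ(a)²`, SAME rate `δ` — the `hT`∕`h342_1` input shape of
`B9Thm37Sum.thm37_entry1` ∕ the Theorem 3.7 glue lineage. [cite: Balaban1985BackgroundPropagators, (3.42) p.397 (first member); Balaban1984PropagatorsII, (2.51) p.232] -/
theorem hasMajorant_conj_G_of_eBlockInv (hE : EBlock (kernelFamilySInv i B cfg O par) B₀ δ U₁) (hB₀ : 0 ≤ B₀)
    (ιB : BlkY i → IBondY i) (hι : ∀ s, β i.hN i.D i.hk (ιB s) = s)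
    {M₂ : ℝ} (hM₂ : 0 ≤ M₂) (hrepr : ∀ (v : 𝔸) (j : ι), |b.repr v j| ≤ M₂ * ‖v‖) {η : ℝ} (hη : η = etaS i)
    (G : Module.End ℝ (SiteY i → 𝔸)) (hG : ∀ Λ, G Λ = (η ^ 2) • O (cfg U₁) Λ) :
    HasMajorant (g := toB6 (geo9K i) Rr Hp) (fun p : SiteY i × ι => ιB (blkOf i.D.toDomains p.1)) (conj b G)
      (fun a a' => M₂ * (∑ j, ‖b j‖) * B₀ * (geo9K i).len a ^ 2 * Real.exp (-(δ * (geo9K i).dist a a'))) :=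
  hasMajorant_conj_G_of_eBlock i b cfg O par (eBlock_kernelFamilyS_of_eBlockInv i b hM₂ hrepr O cfg par hE) hB₀ ιB hι hM₂ hrepr hη G hG

/-- ★★ **entry 1 ⇒ the majorant of `conj b (η⁻¹∇_μ-letter) * conj b (η²O(V))`** (forward letter on the LEFT), profile `ℓ(a)`, SAME rate.
[cite: Balaban1985BackgroundPropagators, (3.42) p.397 (second member); Balaban1984PropagatorsII, (2.51)–(2.52) p.232] -/
theorem hasMajorant_gradF_mul_G_of_eBlockInv (hE : EBlock (kernelFamilySInv i B cfg O par) B₀ δ U₁) (hB₀ : 0 ≤ B₀)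
    (ιB : BlkY i → IBondY i) (hι : ∀ s, β i.hN i.D i.hk (ιB s) = s)
    {M₂ : ℝ} (hM₂ : 0 ≤ M₂) (hrepr : ∀ (v : 𝔸) (j : ι), |b.repr v j| ≤ M₂ * ‖v‖) {η : ℝ} (hη : η = etaS i)
    {Uc : Fin (d + 1) → SiteY i → 𝔸ˣ} (hUc : Uc = UboxY i (cfg U₁))
    (G : Module.End ℝ (SiteY i → 𝔸)) (hG : ∀ Λ, G Λ = (η ^ 2) • O (cfg U₁) Λ) (μ : Fin (d + 1)) :
    HasMajorant (g := toB6 (geo9K i) Rr Hp) (fun p : SiteY i × ι => ιB (blkOf i.D.toDomains p.1))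
      (conj b (diffLetter (shiftY i) Uc (((η : ℂ))⁻¹) (Sum.inl μ)) * conj b G)
      (fun a a' => M₂ * (∑ j, ‖b j‖) * B₀ * (geo9K i).len a * Real.exp (-(δ * (geo9K i).dist a a'))) :=
  hasMajorant_gradF_mul_G_of_eBlock i b cfg O par (eBlock_kernelFamilyS_of_eBlockInv i b hM₂ hrepr O cfg par hE) hB₀ ιB hι hM₂ hrepr hη hUc G hG μ

/-- ★★ **entry 2 ⇒ the majorant of `conj b (η²O(V)) * conj b (−η⁻¹∇*_μ-letter)`** (backward letter on the RIGHT), profile `ℓ(a)`, SAME rate.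
[cite: Balaban1985BackgroundPropagators, (3.42) p.397 (third member); Balaban1984PropagatorsII, (2.51)–(2.52) p.232] -/
theorem hasMajorant_G_mul_gradB_of_eBlockInv (hE : EBlock (kernelFamilySInv i B cfg O par) B₀ δ U₁) (hB₀ : 0 ≤ B₀)
    (ιB : BlkY i → IBondY i) (hι : ∀ s, β i.hN i.D i.hk (ιB s) = s)
    {M₂ : ℝ} (hM₂ : 0 ≤ M₂) (hrepr : ∀ (v : 𝔸) (j : ι), |b.repr v j| ≤ M₂ * ‖v‖) {η : ℝ} (hη : η = etaS i)
    {Uc : Fin (d + 1) → SiteY i → 𝔸ˣ} (hUc : Uc = UboxY i (cfg U₁))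
    (G : Module.End ℝ (SiteY i → 𝔸)) (hG : ∀ Λ, G Λ = (η ^ 2) • O (cfg U₁) Λ) (μ : Fin (d + 1)) :
    HasMajorant (g := toB6 (geo9K i) Rr Hp) (fun p : SiteY i × ι => ιB (blkOf i.D.toDomains p.1))
      (conj b G * conj b (diffLetter (shiftY i) Uc (((η : ℂ))⁻¹) (Sum.inr μ)))
      (fun a a' => M₂ * (∑ j, ‖b j‖) * B₀ * (geo9K i).len a * Real.exp (-(δ * (geo9K i).dist a a'))) :=
  hasMajorant_G_mul_gradB_of_eBlock i b cfg O par (eBlock_kernelFamilyS_of_eBlockInv i b hM₂ hrepr O cfg par hE) hB₀ ιB hι hM₂ hrepr hη hUc G hG μ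

/-- ★★ **entry 3 ⇒ the majorant of `conj b (η⁻²Δ_V) * conj b (η²O(V))`**, profile `1`, SAME rate.
[cite: Balaban1985BackgroundPropagators, (3.42) p.397 (fourth member); Balaban1984PropagatorsII, (2.51)–(2.52) p.232] -/
theorem hasMajorant_lap_mul_G_of_eBlockInv (hE : EBlock (kernelFamilySInv i B cfg O par) B₀ δ U₁) (hB₀ : 0 ≤ B₀)
    (ιB : BlkY i → IBondY i) (hι : ∀ s, β i.hN i.D i.hk (ιB s) = s)
    {M₂ : ℝ} (hM₂ : 0 ≤ M₂) (hrepr : ∀ (v : 𝔸) (j : ι), |b.repr v j| ≤ M₂ * ‖v‖) {η : ℝ} (hη : η = etaS i)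
    (G L : Module.End ℝ (SiteY i → 𝔸)) (hG : ∀ Λ, G Λ = (η ^ 2) • O (cfg U₁) Λ) (hL : ∀ Λ, L Λ = (η ^ 2)⁻¹ • lapS i (cfg U₁) Λ) :
    HasMajorant (g := toB6 (geo9K i) Rr Hp) (fun p : SiteY i × ι => ιB (blkOf i.D.toDomains p.1)) (conj b L * conj b G)
      (fun a a' => M₂ * (∑ j, ‖b j‖) * B₀ * 1 * Real.exp (-(δ * (geo9K i).dist a a'))) :=
  hasMajorant_lap_mul_G_of_eBlock i b cfg O par (eBlock_kernelFamilyS_of_eBlockInv i b hM₂ hrepr O cfg par hE) hB₀ ιB hι hM₂ hrepr hη G L hG hL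

end Read

end Literature.MathematicalPhysics.QuantumFieldTheory.Balaban1983to89.B9CubeLettersInvReadDict

end
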